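import Summits.PneNP.PneNP.Theses.RootDecompQuantumCell
import Literature.Computability.Complexity.ProbabilisticClassesProofs
import Literature.Computability.QuantumComplexity.BQPSubsetPP
import Literature.Computability.QuantumComplexity.SimUniformity

/-! # Root decomposition N19 (QuantumCell) — exactness of the counting-sandwich coordinate

Closes the record aside stmt-PneNP-32710 `QCellIff` of route `route-PneNP-RootDecompQuantumCell`
(decomp-pnenp cell; lens-4 g13 «CountingSandwich», writer g7 rev 2, critic anchor 11:56:04Z):
the hub residual `K : NP ⊆ P → PP ⊆ P` (= `RootDecompSpaceCeiling.CollapseLift`, inlined in the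
item) is equivalent to `QLift ∧ QCatch`, hypothesis-free.

Port of the writer landing certificate `N19QC_landing-g7.lean` (`qCellIff_proof`): `→` uses
`BQP ⊆ PP` (Adleman–DeMarrais–Huang 1997, tree `BQP_subset_PP_holds`) and `P ⊆ BQP`
(tree `P_subset_BPP_holds`, `BPP_subset_BQP_holds`); `←` is transitivity. Standard axioms only.
-/

namespace Summit.PneNP.PneNP.Theorems

open Literature.Computability.Complexity
open Literature.Computability.Cryptography (BQP)

/-- EXACTNESS of the counting-sandwich coordinate on the hub residual `K` (stmt-PneNP-23703):
`(NP ⊆ P → PP ⊆ P) ↔ (QLift ∧ QCatch)`. Closes stmt-PneNP-32710. -/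
theorem qCellIff_proof : Summit.PneNP.PneNP.Theses.RootDecompQuantumCell.QCellIff := by
  unfold Summit.PneNP.PneNP.Theses.RootDecompQuantumCell.QCellIff
    Summit.PneNP.PneNP.Theses.RootDecompQuantumCell.QCatch
    Summit.PneNP.PneNP.Theses.RootDecompQuantumCell.QLift
  have p_subset_bqp : Classes.P ⊆ BQP :=
    (show Classes.P ⊆ BPP from P_subset_BPP_holds).trans
      (show BPP ⊆ BQP from Literature.Computability.QuantumComplexity.BPP_subset_BQP_holds)
  have bqp_subset_pp : BQP ⊆ PP :=
    Literature.Computability.QuantumComplexity.BQP_subset_PP_holds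
  constructor
  · intro hK
    exact ⟨fun hc => bqp_subset_pp.trans (hK hc), fun hc => (hK hc).trans p_subset_bqp⟩
  · rintro ⟨hL, hC⟩ hc
    exact (hC hc).trans (hL hc)

end Summit.PneNP.PneNP.Theorems
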